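/- Width seat `ym-line-sfw-p2-w5` (prover-ym-line-sfw-p2-w5-g18-0), free hands for planner ym-idea-2's STUB-PLAN-E/F (LINE-17 on crux
`AllWindowsColdBox.BoxMidWindowsSU22` = stmt-QuantumFields-24003, stubs E/F): E(3) for an arbitrary sub-family of plaquettes. -/
import Summits.QuantumFields.YangMills.Theorems.AllWindowsColdBoxTiltCubicOnForm
import Summits.QuantumFields.YangMills.Theorems.AllWindowsColdBoxTiltCubicGram

/-!
# The Gram norm of the cubic tensor of a SUB-FAMILY of plaquettes: `Σ BB'ΓΓΓ ≤ 36·D³·M²·#S` (STUB-PLAN-E/F, E(3) for sub-families)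

The sub-family version of `AllWindowsColdBoxTiltCubicGram` (there: `S` = all plaquettes touching the cold box): for any finset `S` of plaquettes
touching the cold box, with `A^S = legTensorOn H S`, `B^S = tiltCubicTensorOn ρ H S`, `G = legGram H` and `C = Q_D⁻¹` (`|C| ≤ M`):
`Σ A^S A^S' CCC = Σ_{q,q' ∈ S} boxDirProjKernel H q q'·G_{qq'}` (`legTensorOn_norm_eq_sum_kernel_mul_legGram`) `≤ Σ_{q ∈ S} G_qq`
(`K ⪯ I` on the sub-family, `sum_kernel_mul_legGram_le_on`) `≤ 9·M²·#S` (`legTensorOn_norm_le`), hence **`sum6_tiltCubicTensorOn_le`**: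
`Σ_{abca'b'c'} B^S B^S' Γ_{aa'}Γ_{bb'}Γ_{cc'} ≤ 36·(dimE ρ)³·M²·#S` for every colour-block-diagonal `Γ` with blocks `Q_D⁻¹` — with `#S = 1` this is
the single-plaquette cubic chaos of obligation F (`‖P₃,p‖₂² ≲ H²` in STUB-PLAN-E §5), with `S = plaquettesTouching Λ` it is E(3).
Everything proved; no definition; standard axioms.  HONEST LABEL: helper toward the open registered stubs E/F of a critic-passed line on the R2ξ″
RECORD-rung crux 24003; no stub is proved by name, no crux, rung or summit is proved; the Yang–Mills mass gap is NOT proved by this file.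
-/

set_option autoImplicit false

noncomputable section

open MeasureTheory Finset Matrix
open Literature.Probability.LatticeModels (Site halfOpenBox)
open Literature.MathematicalPhysics.QuantumLattice
open Literature.MathematicalPhysics.QuantumFieldTheory
open Literature.MathematicalPhysics.QuantumFieldTheory.LatticeMaxwell
open Literature.MathematicalPhysics.QuantumFieldTheory.AxialGauge
open Summit.QuantumFields.YangMills.Theorems.WeakCouplingRates
open Summit.QuantumFields.YangMills.Theorems.FreeEnergyLogCoefficient
open Summit.QuantumFields.YangMills.Theorems.AllWindowsColdBox

namespace Summit.QuantumFields.YangMills.Theorems.ColdBoxAllGroups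

/-! ## §1 Colour separation for the cubic tensor of a sub-family -/

section Tilt

variable {N : ℕ} {G : Type*} [Group G] (ρ : G →* Matrix (Fin N) (Fin N) ℂ) {H : ℕ}

/-- Colour separation for the cubic tensor of a sub-family `S` of plaquettes (instance of `sum6_tensor_blockKernel_eq`). -/
theorem sum6_tiltCubicTensorOn_eq (S : Finset (ZdPlaquette 4)) (C : DirFree H → DirFree H → ℝ)
    (Γ : Fin (dimE ρ) × DirFree H → Fin (dimE ρ) × DirFree H → ℝ) (hΓ : ∀ a b, Γ a b = if a.1 = b.1 then C a.2 b.2 else 0) :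
    (∑ a : Fin (dimE ρ) × DirFree H, ∑ b : Fin (dimE ρ) × DirFree H, ∑ c : Fin (dimE ρ) × DirFree H,
      ∑ a' : Fin (dimE ρ) × DirFree H, ∑ b' : Fin (dimE ρ) × DirFree H, ∑ c' : Fin (dimE ρ) × DirFree H,
        tiltCubicTensorOn ρ H S a b c * tiltCubicTensorOn ρ H S a' b' c' * (Γ a a' * Γ b b' * Γ c c')) =
      (∑ α : Fin (dimE ρ), ∑ β : Fin (dimE ρ), ∑ γ : Fin (dimE ρ),
          chartCubic ρ (EuclideanSpace.single α 1) (EuclideanSpace.single β 1) (EuclideanSpace.single γ 1) ^ 2) *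
        ∑ x : DirFree H, ∑ y : DirFree H, ∑ z : DirFree H, ∑ x' : DirFree H, ∑ y' : DirFree H, ∑ z' : DirFree H,
          legTensorOn H S x y z * legTensorOn H S x' y' z' * (C x x' * C y y' * C z z') :=
  sum6_tensor_blockKernel_eq (fun α β γ => chartCubic ρ (EuclideanSpace.single α 1) (EuclideanSpace.single β 1) (EuclideanSpace.single γ 1))
    (legTensorOn H S) C Γ hΓ

end Tilt

/-! ## §2 The edge factor of a sub-family as projection kernel against the leg-pair Gram matrix, and `K ⪯ I` -/

section Kernel

variable {H : ℕ}

-- The six-fold product index `X⁶` of the flattened edge sums needs a larger instance-size cap (instance TERM size only; no heartbeats change).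
set_option synthInstance.maxSize 512 in
/-- **The edge factor as projection kernel against the leg-pair Gram matrix**:
`Σ_{xyzx'y'z'} A_{xyz}A_{x'y'z'}C_{xx'}C_{yy'}C_{zz'} = Σ_{q,q' touching} boxDirProjKernel H q q' · G_{qq'}` (`C = Q_D⁻¹`). -/
theorem legTensorOn_norm_eq_sum_kernel_mul_legGram (S : Finset (ZdPlaquette 4)) :
    (∑ x : DirFree H, ∑ y : DirFree H, ∑ z : DirFree H, ∑ x' : DirFree H, ∑ y' : DirFree H, ∑ z' : DirFree H,
        legTensorOn H S x y z * legTensorOn H S x' y' z' *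
          ((Qmat (fun e => e ∉ dirFreeEdges H) dirCorner (2 * H + 3))⁻¹ x x' *
            (Qmat (fun e => e ∉ dirFreeEdges H) dirCorner (2 * H + 3))⁻¹ y y' *
            (Qmat (fun e => e ∉ dirFreeEdges H) dirCorner (2 * H + 3))⁻¹ z z')) =
      ∑ q ∈ S, ∑ q' ∈ S,
        boxDirProjKernel H (q.1, q.2.1.1, q.2.1.2) (q'.1, q'.2.1.1, q'.2.1.2) *
          legGram H (q.1, q.2.1.1, q.2.1.2) (q'.1, q'.2.1.1, q'.2.1.2) := by
  classical
  set Qi := (Qmat (fun e => e ∉ dirFreeEdges H) dirCorner (2 * H + 3))⁻¹ with hQi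
  set lam : ZdPlaquette 4 → DirFree H → ℝ := fun q =>
    coeff (fun e => e ∉ dirFreeEdges H) dirCorner (2 * H + 3) ((q.1, q.2.1.1, q.2.1.2) : Plaq 4) with hlam
  set P : ZdPlaquette 4 → DirFree H → DirFree H → ℝ := fun q y z => legPair ((q.1, q.2.1.1, q.2.1.2) : Plaq 4) y z with hP
  -- (b) expand the two leg tensors and bring the plaquette sums outside
  have hb : (∑ x : DirFree H, ∑ y : DirFree H, ∑ z : DirFree H, ∑ x' : DirFree H, ∑ y' : DirFree H, ∑ z' : DirFree H,
        legTensorOn H S x y z * legTensorOn H S x' y' z' * (Qi x x' * Qi y y' * Qi z z')) =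
      ∑ q ∈ S, ∑ q' ∈ S,
        ∑ u : DirFree H × DirFree H × DirFree H × DirFree H × DirFree H × DirFree H,
          lam q u.1 * P q u.2.1 u.2.2.1 * (lam q' u.2.2.2.1 * P q' u.2.2.2.2.1 u.2.2.2.2.2) *
            (Qi u.1 u.2.2.2.1 * Qi u.2.1 u.2.2.2.2.1 * Qi u.2.2.1 u.2.2.2.2.2) := by
    rw [CubicChaos.sum6_eq_sum_prod]
    have hexp : ∀ u : DirFree H × DirFree H × DirFree H × DirFree H × DirFree H × DirFree H,
        legTensorOn H S u.1 u.2.1 u.2.2.1 * legTensorOn H S u.2.2.2.1 u.2.2.2.2.1 u.2.2.2.2.2 *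
            (Qi u.1 u.2.2.2.1 * Qi u.2.1 u.2.2.2.2.1 * Qi u.2.2.1 u.2.2.2.2.2) =
          ∑ q ∈ S, ∑ q' ∈ S,
            lam q u.1 * P q u.2.1 u.2.2.1 * (lam q' u.2.2.2.1 * P q' u.2.2.2.2.1 u.2.2.2.2.2) *
              (Qi u.1 u.2.2.2.1 * Qi u.2.1 u.2.2.2.2.1 * Qi u.2.2.1 u.2.2.2.2.2) := by
      intro u
      rw [legTensorOn, legTensorOn, Finset.sum_mul_sum, Finset.sum_mul]
      refine Finset.sum_congr rfl fun q _ => ?_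
      rw [Finset.sum_mul]
    simp only [hexp]
    exact (Finset.sum_comm).trans (Finset.sum_congr rfl fun q _ => Finset.sum_comm)
  rw [hb]
  refine Finset.sum_congr rfl fun q _ => Finset.sum_congr rfl fun q' _ => ?_
  -- (c) for fixed `q, q'`: reindex the flat sum and compare with the expanded product `K_{qq'} · G_{qq'}`
  set e : DirFree H × DirFree H × DirFree H × DirFree H × DirFree H × DirFree H ≃
      DirFree H × DirFree H × (DirFree H × DirFree H) × (DirFree H × DirFree H) :=
    { toFun := fun u => (u.1, u.2.2.2.1, (u.2.1, u.2.2.1), (u.2.2.2.2.1, u.2.2.2.2.2))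
      invFun := fun v => (v.1, v.2.2.1.1, v.2.2.1.2, v.2.1, v.2.2.2.1, v.2.2.2.2)
      left_inv := fun u => rfl
      right_inv := fun v => rfl } with he
  have hc : (∑ u : DirFree H × DirFree H × DirFree H × DirFree H × DirFree H × DirFree H,
        lam q u.1 * P q u.2.1 u.2.2.1 * (lam q' u.2.2.2.1 * P q' u.2.2.2.2.1 u.2.2.2.2.2) *
          (Qi u.1 u.2.2.2.1 * Qi u.2.1 u.2.2.2.2.1 * Qi u.2.2.1 u.2.2.2.2.2)) =
      ∑ v : DirFree H × DirFree H × (DirFree H × DirFree H) × (DirFree H × DirFree H),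
        lam q v.1 * (Qi v.1 v.2.1 * lam q' v.2.1) *
          (P q v.2.2.1.1 v.2.2.1.2 * P q' v.2.2.2.1 v.2.2.2.2 * (Qi v.2.2.1.1 v.2.2.2.1 * Qi v.2.2.1.2 v.2.2.2.2)) :=
    Fintype.sum_equiv e _ _ fun u => by simp only [he, Equiv.coe_fn_mk]; ring
  rw [hc, boxDirProjKernel, legGram]
  simp only [dotProduct, Matrix.mulVec, hlam, hP, hQi, Fintype.sum_prod_type]
  -- distribute the product `(Σ_x λ·(Σ_x' C λ')) · (Σ_y Σ_z Σ_y' Σ_z' …)` in the fixed order `x, x', y, z, y', z'`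
  rw [Finset.sum_mul]
  refine Finset.sum_congr rfl fun x _ => ?_
  rw [mul_assoc, Finset.sum_mul, Finset.mul_sum]
  refine Finset.sum_congr rfl fun x' _ => ?_
  simp only [Finset.mul_sum]
  refine Finset.sum_congr rfl fun y _ => Finset.sum_congr rfl fun z _ => Finset.sum_congr rfl fun y' _ =>
    Finset.sum_congr rfl fun z' _ => ?_
  ring

/-- **`K ⪯ I` applied**: `Σ_{q,q' touching} boxDirProjKernel H q q' · G_{qq'} ≤ Σ_{q touching} G_{qq}` (the Gram lemma
`sum_sum_boxDirProjKernel_mul_gram_le` with the Gram vectors `legGramVec`, transported from Chatterjee's coordinates of the enlarged box). -/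
theorem sum_kernel_mul_legGram_le_on (S : Finset (ZdPlaquette 4))
    (hST : S ⊆ plaquettesTouching (boxEdges 4 (2 * H + 1))) :
    (∑ q ∈ S, ∑ q' ∈ S,
        boxDirProjKernel H (q.1, q.2.1.1, q.2.1.2) (q'.1, q'.2.1.1, q'.2.1.2) *
          legGram H (q.1, q.2.1.1, q.2.1.2) (q'.1, q'.2.1.1, q'.2.1.2)) ≤
      ∑ q ∈ S, legGram H (q.1, q.2.1.1, q.2.1.2) (q.1, q.2.1.1, q.2.1.2) := by
  classical
  have hinj : Set.InjOn (fun p : ZdPlaquette 4 => ((p.1 - dirCorner, p.2.1.1, p.2.1.2) : Plaq 4)) ↑S :=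
    unshift_dirCorner_injective.injOn
  have hS : S.image (fun p : ZdPlaquette 4 => ((p.1 - dirCorner, p.2.1.1, p.2.1.2) : Plaq 4)) ⊆
      plaquettesIn (halfOpenBox 4 (2 * H + 3)) := by
    intro p hp
    obtain ⟨q, hq, rfl⟩ := Finset.mem_image.1 hp
    exact unshift_mem_plaquettesIn (hST hq)
  have key := sum_sum_boxDirProjKernel_mul_gram_le H
    (plaquettesIn (halfOpenBox 4 (2 * H + 3)) ×ˢ plaquettesIn (halfOpenBox 4 (2 * H + 3))) _ hS
    (fun mn p => legGramVec H mn (Plaq.shift dirCorner p))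
  simp only [Finset.sum_image hinj, shift_unshift_dirCorner] at key
  simpa only [← legGram_eq_sum_legGramVec, sq] using key

/-- **E(3), edge factor**: `Σ_{xyzx'y'z'} A_{xyz}A_{x'y'z'}C_{xx'}C_{yy'}C_{zz'} ≤ 9·M²·#(plaquettes touching Λ)` for `C = Q_D⁻¹` with `|C| ≤ M`. -/
theorem legTensorOn_norm_le (S : Finset (ZdPlaquette 4)) (hST : S ⊆ plaquettesTouching (boxEdges 4 (2 * H + 1))) {M : ℝ} (hM : ∀ y y', |(Qmat (fun e => e ∉ dirFreeEdges H) dirCorner (2 * H + 3))⁻¹ y y'| ≤ M) :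
    (∑ x : DirFree H, ∑ y : DirFree H, ∑ z : DirFree H, ∑ x' : DirFree H, ∑ y' : DirFree H, ∑ z' : DirFree H,
        legTensorOn H S x y z * legTensorOn H S x' y' z' *
          ((Qmat (fun e => e ∉ dirFreeEdges H) dirCorner (2 * H + 3))⁻¹ x x' *
            (Qmat (fun e => e ∉ dirFreeEdges H) dirCorner (2 * H + 3))⁻¹ y y' *
            (Qmat (fun e => e ∉ dirFreeEdges H) dirCorner (2 * H + 3))⁻¹ z z')) ≤
      9 * M ^ 2 * #S := by
  rw [legTensorOn_norm_eq_sum_kernel_mul_legGram S]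
  refine (sum_kernel_mul_legGram_le_on S hST).trans ?_
  calc ∑ q ∈ S, legGram H (q.1, q.2.1.1, q.2.1.2) (q.1, q.2.1.1, q.2.1.2)
      ≤ ∑ _q ∈ S, 9 * M ^ 2 :=
        Finset.sum_le_sum fun q _ => by rw [legGram]; exact gramDiag_le _ _ hM
    _ = 9 * M ^ 2 * #S := by
        rw [Finset.sum_const, nsmul_eq_mul]; ring

end Kernel

/-! ## §5 E(3): the Gram norm of the cubic tensor of the tilt -/

section Final

variable {N : ℕ} {G : Type*} [Group G] (ρ : G →* Matrix (Fin N) (Fin N) ℂ) {H : ℕ}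

/-- **E(3).**  For every colour-block-diagonal kernel `Γ_{ab} = [a₁ = b₁]·(Q_D⁻¹)_{a₂b₂}` (the two-point function of the coordinate process of
`gaussD`) and every entrywise bound `|(Q_D⁻¹)_{yy'}| ≤ M`:
`Σ_{abca'b'c'} B_{abc}B_{a'b'c'}Γ_{aa'}Γ_{bb'}Γ_{cc'} ≤ 36·(dimE ρ)³·M²·#(plaquettesTouching Λ)`, `B = tiltCubicTensorOn ρ H S` — the right-hand side of
`CubicChaos.integral_cubicForm_sq_le` for the cubic part of the tilt (with `tiltCubicW = (√β)⁻¹·Σ B·XXX`: `Var(tiltCubicW) ≤ 216·D³·M²·#touching/β`). -/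
theorem sum6_tiltCubicTensorOn_le (S : Finset (ZdPlaquette 4)) (hST : S ⊆ plaquettesTouching (boxEdges 4 (2 * H + 1)))
    (Γ : Fin (dimE ρ) × DirFree H → Fin (dimE ρ) × DirFree H → ℝ)
    (hΓ : ∀ a b, Γ a b = if a.1 = b.1 then (Qmat (fun e => e ∉ dirFreeEdges H) dirCorner (2 * H + 3))⁻¹ a.2 b.2 else 0) {M : ℝ}
    (hM : ∀ y y', |(Qmat (fun e => e ∉ dirFreeEdges H) dirCorner (2 * H + 3))⁻¹ y y'| ≤ M) :
    (∑ a : Fin (dimE ρ) × DirFree H, ∑ b : Fin (dimE ρ) × DirFree H, ∑ c : Fin (dimE ρ) × DirFree H,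
      ∑ a' : Fin (dimE ρ) × DirFree H, ∑ b' : Fin (dimE ρ) × DirFree H, ∑ c' : Fin (dimE ρ) × DirFree H,
        tiltCubicTensorOn ρ H S a b c * tiltCubicTensorOn ρ H S a' b' c' * (Γ a a' * Γ b b' * Γ c c')) ≤
      36 * (dimE ρ : ℝ) ^ 3 * M ^ 2 * #S := by
  have hsep := sum6_tiltCubicTensorOn_eq ρ S _ Γ hΓ
  rw [hsep]
  set NA := ∑ x : DirFree H, ∑ y : DirFree H, ∑ z : DirFree H, ∑ x' : DirFree H, ∑ y' : DirFree H, ∑ z' : DirFree H,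
      legTensorOn H S x y z * legTensorOn H S x' y' z' *
        ((Qmat (fun e => e ∉ dirFreeEdges H) dirCorner (2 * H + 3))⁻¹ x x' *
          (Qmat (fun e => e ∉ dirFreeEdges H) dirCorner (2 * H + 3))⁻¹ y y' *
          (Qmat (fun e => e ∉ dirFreeEdges H) dirCorner (2 * H + 3))⁻¹ z z') with hNA
  set Tτ := ∑ α : Fin (dimE ρ), ∑ β : Fin (dimE ρ), ∑ γ : Fin (dimE ρ),
      chartCubic ρ (EuclideanSpace.single α 1) (EuclideanSpace.single β 1) (EuclideanSpace.single γ 1) ^ 2 with hTτ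
  have hτ : Tτ ≤ 4 * (dimE ρ : ℝ) ^ 3 := sum_sq_chartCubic_single_le ρ
  have hτ0 : 0 ≤ Tτ := Finset.sum_nonneg fun _ _ => Finset.sum_nonneg fun _ _ => Finset.sum_nonneg fun _ _ => sq_nonneg _
  have hNAle : NA ≤ 9 * M ^ 2 * #S := legTensorOn_norm_le (H := H) S hST hM
  have hD : 0 ≤ 4 * (dimE ρ : ℝ) ^ 3 := mul_nonneg (by norm_num) (pow_nonneg (Nat.cast_nonneg _) 3)
  rcases le_or_gt 0 NA with h0 | h0
  · calc Tτ * NA ≤ 4 * (dimE ρ : ℝ) ^ 3 * (9 * M ^ 2 * #S) :=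
          mul_le_mul hτ hNAle h0 hD
      _ = _ := by ring
  · have h1 : Tτ * NA ≤ 0 := mul_nonpos_iff.2 (Or.inl ⟨hτ0, h0.le⟩)
    have h2 : 0 ≤ 36 * (dimE ρ : ℝ) ^ 3 * M ^ 2 * #S :=
      mul_nonneg (mul_nonneg (mul_nonneg (by norm_num) (pow_nonneg (Nat.cast_nonneg _) 3)) (sq_nonneg M)) (Nat.cast_nonneg _)
    exact h1.trans h2

end Final

end Summit.QuantumFields.YangMills.Theorems.ColdBoxAllGroups

end
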